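import Summits.BirchSwinnertonDyer.BirchSwinnertonDyer.Theorems.AdditiveBranchIMCGordTwoTwistedWanDefs
import Summits.BirchSwinnertonDyer.BirchSwinnertonDyer.Theorems.AdditiveBranchIMCGordTwoTwistedDyadicClass
import HarnessLib

/-!
# Route `AdditiveBranchIMC`, cruxes `GordTwoRankZeroOffCaseOne` (19357) / `GordTwoRankOne` (19358): the VOCABULARY of DOOR D — «the
# DYADIC prime `ℓ₀ = 2` as the `K`-RAMIFIED twisted Wan prime» — under the Theorems import fence (definitions + three one-line lemmas;
# nothing asserted, nothing booked)

DRAFT by the pen (planner bsd-addord-plan g48, memo `planner/g2_3f_enlarge/e22/`), the `ℓ₀ = 2` companion of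
`AdditiveBranchIMCGordTwoTwistedWanDefs.lean` (p-numbers there), landable VERBATIM by the LEAD lineage as
`Theorems/AdditiveBranchIMCGordTwoTwistedWanTwoDefs.lean` (`--kind definition --supports stmt-BirchSwinnertonDyer-19357 --as helper`), so that
(i) the LEAD's door-D kernel (frame / engine₂ / supply₂, LeadReport26 rev 2 §4.1) and the three WANTED typer rows R2₂ / R3₂ / R4₂
(wi-101331 / wi-101332 / wi-101333) are stated over NAMED predicates, and (ii) the registered residual stubs of 19357 / 19358 can later be
reshaped by ONE more negated hypothesis `¬ TwistedWanRowR0Two W p` / `¬ TwistedWanRoadRowTwo W p` and closed BY NAME, exactly as bricks E2 / E3′.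

THE DICTIONARY `ℓ₀ ↦ 2` (pen memo e21 §1–§3c; census e20: +476 r₁ / +426 r₀ rows `N < 10⁴` whose ONLY potentially-multiplicative additive
twist-type prime is `2`). `E` (globally minimal `W`) ADDITIVE at `2` of quadratic-twist type and potentially multiplicative there: `W₁ := E^{(t)}`
MULTIPLICATIVE at `2` for one `t ∈ {−1, 2, −2}` (prime discriminant `t* = disc ℚ(√t) = 4t ∈ {−4, 8, −8}` replaces `ℓ₀* = (−1)^{(ℓ₀−1)/2}ℓ₀`).
Road field `K` imaginary quadratic with `2` RAMIFIED, `d_K = 4·t·n`, `n ≡ 1 (mod 4)` — THE LEAD's SPELLING (p814401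
`TwistedWanRoad.quadraticTwist_discr_nonsplit_at_two_of_dyadicClass` / `baseChange_nonsplit_two_of_dyadicClass`), adopted here so that the class
theorem plugs in with no conversion: the NON-SPLIT genus class is `n ≡ 1 (mod 8)` if `W₁` is non-split at `2`, `n ≡ 5 (mod 8)` if split
(`E^{(d_K)} ≅ W₁^{(n)}`, an unramified twist at `2`; `E/K_𝔮 = (W₁ ⊗ ν)/K_𝔮` with `ν = χ_{4t} ∘ N_{K/ℚ}` the everywhere-unramified genus character,
`ν(𝔮) = χ_n(2)`). At `ℓ₀ = 2` the depletion constant of the `f_E`-keyed displays is `1 + 2⁻¹ = 3/2`, a `p`-adic unit for every `p ≥ 5`: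
door D has NO unit cut and NO class cut (both split types of `W₁` at `2` own a genus class).

* `TwistedWanPrimeTwo W p t` — `p ≠ 2`, `t ∈ {−1, 2, −2}`, `E` additive at `2`, `W₁ = E^{(t)}` multiplicative at `2`, `p ∤ v_2(j)`;
* `NonsplitClassAtTwo W t K` — `∃ n, d_K = 4·t·n ∧ n % 8 = (5 if W₁ split at 2, else 1)`;
* `TameRoadFieldTwistedTwo W p t K` — the door-D road field (every ODD prime of `N_E` split; `p` split);
* `TwistedWanRoadRowTwo` (rank-one key, crux 19358) / `TwistedWanRowR0Two` (rank-zero key, crux 19357: + `p ∤ ∏ c_ℓ`) and the projection;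
* `FieldOneTwistedTwo` / `FieldOneTwistedR0Two` — the field-one supply statements (kernel: Hoffstein–Luo on `W₁` with the class of `n` prescribed,
  precedent `GordTwoRankOneFieldSupplyDyadic.fieldOneTwo_of_engineTwo` p776858, after the engine);
* `EngineTwistedTwo` — the statement «`w(E^{(d_K)}) = −w(E)` on a door-D road field» (kernel ENGINE₂: `λ₂(f_E) = χ_t(−1)` p814752, the unramified
  twist at `2` p812548 / p814401 (`w_2(W₁^{(n)}) = +1` in the non-split class), coprime twist law at the odd places (all odd primes of `N_E` split in
  `K`, so `χ_{d_K}` is locally trivial there; at the odd `r ∣ n`, `E` good, `w_r = χ_r(−1)`): `w(E^{(d_K)})/w(E) = χ_t(−1)·sgn(n) = sgn(t)·(−sgn t) = −1`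
  since `d_K = 4tn < 0`);
* lemmas: `two_dvd_discr_of_nonsplitClassAtTwo`, `baseChange_nonsplit_two_of_tameRoadFieldTwistedTwo` (= p814401 read through the predicates:
  the binder «`E/K` non-split multiplicative above `2`» of R2₂/R3₂/R4₂), `twistedWanRoadRowTwo_of_twistedWanRowR0Two`.

HONEST FRAMING: definitions, statements and three unfolding lemmas; no named fact is minted (no cite tag on a parameterless statement `def`),
nothing is booked; 19357 / 19358 stay OPEN; the director's call on door D (price sheet TARGET E377) is pending — this file books nothing either way.
BSD is proved for no curve. A planner does not land Theorems files (D-0014): the LEAD lands it after its decl-name grep (director (744)/(746)/(749)).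
References: [SkinnerUrban2014] Thm. 3.6.4; [Gross2004] §2; [CastellaLiuWan2022] §5.2; [Hsieh2014] Thm. B; [LiuZhangZhang2018] §1.5;
[CaiShuTian2014] Thm 1.1, Prop 3.12; [HoffsteinLuo1997] §1; [Rohrlich1993Compositio] Prop. 2 (iii); [AtkinLi1978] §3; [SilvermanAEC2009] X.5 Cor. 5.4.
presearch: n/a (route vocabulary; the print behind each statement is cited in `AdditiveBranchIMCGordTwoTwistedWanDefs.lean` and the typer rows).
-/

set_option autoImplicit false
set_option linter.dupNamespace false

noncomputable section

open scoped Classical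

open NumberField IsDedekindDomain IsDedekindDomain.HeightOneSpectrum Rat.HeightOneSpectrum
open WeierstrassCurve Literature.NumberTheory.EllipticCurves
  Literature.NumberTheory.EllipticCurves.ModularForms
  Literature.NumberTheory.EllipticCurves.Rank1Residual
open Summit.BirchSwinnertonDyer.Rank1Residual
open Summit.BirchSwinnertonDyer.Rank1Residual.Additive
open Summit.BirchSwinnertonDyer.BirchSwinnertonDyer.Theorems

namespace Summit.BirchSwinnertonDyer.BirchSwinnertonDyer.Theorems.TwistedWanRoad

/-- THE DYADIC TWISTED WAN PRIME (e21 sketch, spelling aligned with p814401): `p` odd; `E` (globally minimal `W`) ADDITIVE at `2` of quadratic-twist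
type AND potentially multiplicative — `W₁ := E^{(t)}` multiplicative at `2` for the twist `t ∈ {−1, 2, −2}` —, with Skinner–Urban's ramification
clause `p ∤ v_2(j)` (`j(E) = j(W₁)`, `v_2(j) = −v_2(Δ_min(W₁))`: `ρ̄_{E,p}|_{G_{K_𝔮}}` ramified). The `ℓ₀ = 2` companion of `TwistedWanPrime`
(whose `ℓ ≠ 2` excludes exactly these rows). [predicate; nothing asserted] -/
def TwistedWanPrimeTwo (W : WeierstrassCurve ℚ) [W.IsElliptic] (p : ℕ) (t : ℤ) : Prop :=
  p ≠ 2 ∧ (t = -1 ∨ t = 2 ∨ t = -2) ∧ W.HasAdditiveReductionAt ((primesEquiv (R := ℤ)).symm ⟨2, Nat.prime_two⟩) ∧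
    (W.quadraticTwist (t : ℚ)).HasMultiplicativeReductionAtPrime 2 ∧
    ¬ (p : ℤ) ∣ padicValRat 2 W.j

/-- THE GENUS CLASS AT `2` (p814401's hypotheses `hn` / `hclass` bundled): `d_K = 4·t·n` with `n ≡ 5 (mod 8)` if `W₁ = E^{(t)}` is SPLIT
multiplicative at `2` and `n ≡ 1 (mod 8)` if it is non-split (`Int.emod`: a negative `n` is read in `{1, 5}` too; either way `n ≡ 1 (mod 4)`, so
`4t ∥ d_K`, `2` is RAMIFIED in `K`, `ν = χ_{4t}∘N` is unramified and `ν(𝔮) = χ_n(2)`) — the class `a_2(W₁)·χ_n(2) = −1` for which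
`E^{(d_K)} ≅ W₁^{(n)}` is non-split at `2` and `E/K_𝔮` is NON-SPLIT multiplicative. The `ℓ₀ = 2` companion of `NonsplitClassAt`.
[predicate; nothing asserted] -/
def NonsplitClassAtTwo (W : WeierstrassCurve ℚ) [W.IsElliptic] (t : ℤ) (K : Type) [Field K] [NumberField K] : Prop :=
  ∃ n : ℤ, NumberField.discr K = 4 * t * n ∧
    n % 8 = (if (W.quadraticTwist (t : ℚ)).HasSplitMultiplicativeReductionAtPrime 2 then 5 else 1)

/-- THE DOOR-D ROAD FIELD: `K` imaginary quadratic, `d_K < −4`, the dyadic twisted Wan prime in its non-split genus class (`2` RAMIFIED in `K`),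
every ODD prime of `N_E` split in `K` (among them `p`, additive for `E`: `SatisfiesHeegnerHypothesis p K` = `p` split). The `ℓ₀ = 2` companion of
`TameRoadFieldTwisted` (whose clause «`2` split if `2 ∤ N_E`» is void here: `4 ∣ N_E`). [predicate; nothing asserted] -/
def TameRoadFieldTwistedTwo (W : WeierstrassCurve ℚ) [W.IsElliptic] [W.IsGloballyMinimal] (p : ℕ) (t : ℤ)
    (K : Type) [Field K] [NumberField K] : Prop :=
  IsImaginaryQuadratic K ∧ NumberField.discr K < -4 ∧ TwistedWanPrimeTwo W p t ∧ NonsplitClassAtTwo W t K ∧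
    (∀ r : ℕ, r.Prime → r ∣ W.conductorNorm ℤ → r ≠ 2 → ((Ideal.span {(r : ℤ)}).primesOver (𝓞 K)).ncard = 2) ∧
    SatisfiesHeegnerHypothesis p K

/-- THE DOOR-D SUB-ROW OF THE RANK-ONE LINE (crux 19358): `p ≥ 5`, `ρ̄_{E,p}` onto, every additive prime `≠ p` of quadratic-twist type (the two
clauses of `TwistedWanRoadRow` verbatim), and a DYADIC twisted Wan prime. NO unit cut (`p ∤ 2 + 1` is automatic for `p ≥ 5`), NO class cut.
[predicate; nothing asserted] -/
def TwistedWanRoadRowTwo (W : WeierstrassCurve ℚ) [W.IsElliptic] [W.IsGloballyMinimal] (p : ℕ) [Fact p.Prime] : Prop :=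
  5 ≤ p ∧ Surj W p ∧
    (∀ r : Nat.Primes, (r : ℕ) = 2 → W.HasAdditiveReductionAt ((primesEquiv (R := ℤ)).symm r) →
      ∃ t : ℤ, (t = -1 ∨ t = 2 ∨ t = -2) ∧
        ¬ (W.quadraticTwist (t : ℚ)).HasAdditiveReductionAt ((primesEquiv (R := ℤ)).symm r)) ∧
    (∀ r : Nat.Primes, (r : ℕ) ≠ 2 → W.HasAdditiveReductionAt ((primesEquiv (R := ℤ)).symm r) →
      ¬ (W.quadraticTwist (((-1 : ℤ) ^ ((r : ℕ) / 2) * r : ℤ) : ℚ)).HasAdditiveReductionAt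
        ((primesEquiv (R := ℤ)).symm r)) ∧
    (∃ t : ℤ, TwistedWanPrimeTwo W p t)

/-- THE DOOR-D SUB-ROW OF THE RANK-ZERO LINE (crux 19357 `three_field_road`): the rank-one clauses and the r₀ Tamagawa clause `p ∤ ∏ c_ℓ`
(as `TwistedWanRowR0`). [predicate; nothing asserted] -/
def TwistedWanRowR0Two (W : WeierstrassCurve ℚ) [W.IsElliptic] [W.IsGloballyMinimal] (p : ℕ) [Fact p.Prime] : Prop :=
  5 ≤ p ∧ Surj W p ∧
    (∀ r : Nat.Primes, (r : ℕ) = 2 → W.HasAdditiveReductionAt ((primesEquiv (R := ℤ)).symm r) →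
      ∃ t : ℤ, (t = -1 ∨ t = 2 ∨ t = -2) ∧
        ¬ (W.quadraticTwist (t : ℚ)).HasAdditiveReductionAt ((primesEquiv (R := ℤ)).symm r)) ∧
    (∀ r : Nat.Primes, (r : ℕ) ≠ 2 → W.HasAdditiveReductionAt ((primesEquiv (R := ℤ)).symm r) →
      ¬ (W.quadraticTwist (((-1 : ℤ) ^ ((r : ℕ) / 2) * r : ℤ) : ℚ)).HasAdditiveReductionAt
        ((primesEquiv (R := ℤ)).symm r)) ∧
    (∃ t : ℤ, TwistedWanPrimeTwo W p t) ∧ ¬ p ∣ W.tamagawaProduct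

/-- The rank-zero door-D sub-row is the rank-one sub-row with the Tamagawa clause (projection). [folklore] -/
theorem twistedWanRoadRowTwo_of_twistedWanRowR0Two (W : WeierstrassCurve ℚ) [W.IsElliptic] [W.IsGloballyMinimal] (p : ℕ)
    [Fact p.Prime] (h : TwistedWanRowR0Two W p) : TwistedWanRoadRowTwo W p ∧ ¬ p ∣ W.tamagawaProduct :=
  ⟨⟨h.1, h.2.1, h.2.2.1, h.2.2.2.1, h.2.2.2.2.1⟩, h.2.2.2.2.2⟩

/-- In the genus class at `2`, `2 ∣ d_K` (`2` is ramified in `K`): the binder `(2 : ℤ) ∣ NumberField.discr K` of the typer rows R2₂/R3₂/R4₂.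
[folklore] -/
theorem two_dvd_discr_of_nonsplitClassAtTwo (W : WeierstrassCurve ℚ) [W.IsElliptic] (t : ℤ) (K : Type) [Field K] [NumberField K]
    (h : NonsplitClassAtTwo W t K) : (2 : ℤ) ∣ NumberField.discr K := by
  obtain ⟨n, hn, -⟩ := h
  exact ⟨2 * t * n, by rw [hn]; ring⟩

/-- **On a door-D road field `E/K` is NON-SPLIT multiplicative at the prime above `2`** — p814401
(`baseChange_nonsplit_two_of_dyadicClass`) read through the named predicates: the binder «`∀ v ∋ 2, (W.baseChange K) multiplicative ∧ ¬ split
at v`» of the typer rows R2₂/R3₂/R4₂. [cite: SilvermanAEC2009, VII.5 Prop. 5.1 (b), Prop. 5.4 (b), X.5 Cor. 5.4] -/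
theorem baseChange_nonsplit_two_of_tameRoadFieldTwistedTwo (W : WeierstrassCurve ℚ) [W.IsElliptic] [W.IsGloballyMinimal] (p : ℕ)
    (t : ℤ) (K : Type) [Field K] [NumberField K] (h : TameRoadFieldTwistedTwo W p t K) :
    ∀ v : HeightOneSpectrum (𝓞 K), ((2 : ℕ) : 𝓞 K) ∈ v.asIdeal →
      (W.baseChange K).HasMultiplicativeReductionAt v ∧ ¬ (W.baseChange K).HasSplitMultiplicativeReductionAt v := by
  obtain ⟨hK, -, ⟨-, ht, -, hmult, -⟩, ⟨n, hn, hclass⟩, -, -⟩ := h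
  exact baseChange_nonsplit_two_of_dyadicClass W ht hmult K hK hn hclass

/-- THE DOOR-D RANK-ONE FIELD SUPPLY (statement; the `ℓ₀ = 2` companion of `FieldOneTwistedCutOne`): for modular `E` of root number `−1` whose
odd additive primes are of twist type and a dyadic twisted Wan prime `t` (so `E` IS additive at `2`), arbitrarily large door-D road fields `K` with
`L(E^{(d_K)}, 1) ≠ 0`. Intended proof (LEAD kernel SUPPLY₂, [M]): `E^{(d_K)} ≅ W₁^{(n)}`; Dirichlet for the class of `n` modulo `8` and modulo the odd
primes of `2pN₁`; Hoffstein–Luo 1997 on `W₁` (semistable at `2`) with those square classes prescribed (precedent p776858 `fieldOneTwo_of_engineTwo`,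
`d_K = 8ℓ₁d`), after `EngineTwistedTwo`. LINE VOCABULARY, not a Literature fact. [statement only; nothing asserted] -/
def FieldOneTwistedTwo : Prop :=
  ∀ (W : WeierstrassCurve ℚ) [W.IsElliptic] [W.IsGloballyMinimal], exists_isNewformOf →
    (∀ r : Nat.Primes, (r : ℕ) ≠ 2 → W.HasAdditiveReductionAt ((primesEquiv (R := ℤ)).symm r) →
      ¬ (W.quadraticTwist (((-1 : ℤ) ^ ((r : ℕ) / 2) * r : ℤ) : ℚ)).HasAdditiveReductionAt
        ((primesEquiv (R := ℤ)).symm r)) →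
    W.rootNumber = -1 →
    ∀ (p : ℕ) (t : ℤ), p.Prime → TwistedWanPrimeTwo W p t → ∀ B : ℕ,
      ∃ (K : Type) (_ : Field K) (_ : NumberField K),
        TameRoadFieldTwistedTwo W p t K ∧ B < (NumberField.discr K).natAbs ∧
          (W.quadraticTwist (NumberField.discr K : ℚ)).entireLFunction 1 ≠ 0

/-- THE DOOR-D RANK-ZERO FIELD SUPPLY (statement; the `ℓ₀ = 2` companion of `FieldOneTwistedR0CutOne`, FIELD 1 of the r₀ kernel): root number
`+1`, arbitrarily large door-D road fields `K` with `L(E^{(d_K)}, s)` vanishing to order exactly one at `s = 1` (Hoffstein–Luo / Friedberg–Hoffstein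
second alternative on `W₁` with the class of `n` prescribed). LINE VOCABULARY, not a Literature fact. [statement only; nothing asserted] -/
def FieldOneTwistedR0Two : Prop :=
  ∀ (W : WeierstrassCurve ℚ) [W.IsElliptic] [W.IsGloballyMinimal], exists_isNewformOf →
    (∀ r : Nat.Primes, (r : ℕ) ≠ 2 → W.HasAdditiveReductionAt ((primesEquiv (R := ℤ)).symm r) →
      ¬ (W.quadraticTwist (((-1 : ℤ) ^ ((r : ℕ) / 2) * r : ℤ) : ℚ)).HasAdditiveReductionAt
        ((primesEquiv (R := ℤ)).symm r)) →
    W.rootNumber = 1 →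
    ∀ (p : ℕ) (t : ℤ), p.Prime → TwistedWanPrimeTwo W p t → ∀ B : ℕ,
      ∃ (K : Type) (_ : Field K) (_ : NumberField K),
        TameRoadFieldTwistedTwo W p t K ∧ B < (NumberField.discr K).natAbs ∧
          (W.quadraticTwist (NumberField.discr K : ℚ)).entireLFunction 1 = 0 ∧
          deriv (W.quadraticTwist (NumberField.discr K : ℚ)).entireLFunction 1 ≠ 0

/-- THE DOOR-D ROOT-NUMBER ENGINE (statement; the `ℓ₀ = 2` companion of `EngineTwistedNoAddTwo` — here `E` IS additive at `2`): for modular `E`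
whose odd additive primes are of quadratic-twist type and a door-D road field `K` at the dyadic twisted Wan prime `t`, `w(E^{(d_K)}) = −w(E)`.
Sign bookkeeping (pen e21 §3c / LEAD LeadReport26 §4.1): `w_2(E) = λ₂(f_E) = χ_t(−1) = sgn t` (p814752); `E^{(d_K)} ≅ W₁^{(n)}` is multiplicative
NON-split at `2` in the class (p814401), `w_2 = +1`; every odd prime of `N_E` splits in `K` (`χ_{d_K}` locally trivial: equal local signs); at an odd
`r ∣ n` (`E` good) `w_r(E^{(d_K)}) = χ_r(−1)`, product `sgn n`; `∞`: equal. Total `χ_t(−1)·sgn(n) = −1` because `d_K = 4tn < 0`. Proof = LEAD kernel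
ENGINE₂ [M]. [statement only; nothing asserted] -/
def EngineTwistedTwo : Prop :=
  ∀ (W : WeierstrassCurve ℚ) [W.IsElliptic] [W.IsGloballyMinimal], exists_isNewformOf →
    (∀ r : Nat.Primes, (r : ℕ) ≠ 2 → W.HasAdditiveReductionAt ((primesEquiv (R := ℤ)).symm r) →
      ¬ (W.quadraticTwist (((-1 : ℤ) ^ ((r : ℕ) / 2) * r : ℤ) : ℚ)).HasAdditiveReductionAt
        ((primesEquiv (R := ℤ)).symm r)) →
    ∀ (p : ℕ) (t : ℤ) (K : Type) [Field K] [NumberField K], TameRoadFieldTwistedTwo W p t K →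
      (W.quadraticTwist (NumberField.discr K : ℚ)).rootNumber = -W.rootNumber

end Summit.BirchSwinnertonDyer.BirchSwinnertonDyer.Theorems.TwistedWanRoad

end
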